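import Summits.FinalStateConjecture.FinalStateConjecture.Theorems.BartnikGapSettlingGapExhaustionIKLocalStepTOfConstants
import Summits.FinalStateConjecture.FinalStateConjecture.Theorems.BartnikGapSettlingGapExhaustionIKStepNormalisedDataTFar
import Summits.FinalStateConjecture.FinalStateConjecture.Theorems.BartnikGapSettlingGapExhaustionIKStepBoundAFar
import HarnessLib

/-!
# Crux `GapExhaustion` (stmt-FinalStateConjecture-10808), line `photon-shell-pseudoconvexity`:
# stub (V-6T-far) `ikLocalStepTFar_of_constants` — the SCALE-FREE local step of the
# `T`-conditional sweep at a FAR cylinder point, constants first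

Route `BartnikGapSettling`; helper (`--supports stmt-FinalStateConjecture-10808`) of line lead
c12 (far chain F1). The far twin of V-6T `ikLocalStepT_of_constants`: at a cylinder point `x`
with `r(x) = c` in a far band the data are normalised at the scale `s = c · su'` (a fixed
fraction of the radius), the defining function and the conditioning vector carry the factor `c`
(`ft = c s⁻² (r ∘ aff − c)`, `τ = c • Ls⁻¹ ∂₀`), and every hypothesis is scale-free: far
derivative bounds `‖Dʲ G‖ ≤ (CK+1) M / r^{j+1}`, `‖Dʲ r‖ ≤ CK / r^{j−1}` on the tube, the far
POINT multiplier `ε₁²‖w‖² ≤ μ G_x(w,w) − c Hess r(w,w) + ε₁⁻²(G_x(∂₀,w)² + dr(w)²)`, stationarity,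
and balls measured in fractions of `c` (`ball x (ρf c) → ball x (ρf' c)`). Then IK's constants
`A` (F1b `stub_ikStepBoundAFar`), `A₁` and the hypotheses at the origin (F1a `stub_ikQuant6TFar`)
do not depend on `c`, and the `T`-conditional local extension theorem (hypothesis `hIKC`,
verbatim `Literature…IonescuKlainermanConditionalLocalExtension`) yields ONE output fraction.
-/

noncomputable section

set_option maxSynthPendingDepth 3

-- D-0017: single-problem summit, `Summit.<S>.<S>.…` by design (cf. lakefile `weak.linter.dupNamespace`).
set_option linter.dupNamespace false

namespace Summit.FinalStateConjecture.FinalStateConjecture.Theorems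

open Set Function Metric
open Literature.Geometry.Lorentzian Literature.Geometry.Lorentzian.MetricCoord
open scoped Manifold ContDiff Topology ENNReal

/-- Registration handle (the main theorem's signature exceeds the 4000-character stub cap): the
scaled frame at a far point has operator norm `≤ 6 c su'`. [folklore] -/
theorem ikStepTFar_norm_Ls : ∀ (c su : ℝ) (L Ls : E4 ≃L[ℝ] E4), 0 < c → 0 < su →
    (Ls : E4 →L[ℝ] E4) = (c * su) • (L : E4 →L[ℝ] E4) → ‖(L : E4 →L[ℝ] E4)‖ ≤ 6 →
    ‖(Ls : E4 →L[ℝ] E4)‖ ≤ 6 * (c * su) := by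
  intro c su L Ls hc hsu hLs hL6
  exact ikStep_norm_Ls (mul_pos hc hsu) hLs hL6

/-- **The scale-free local step of the `T`-conditional sweep at a far cylinder point, constants
first.** For all constants `ε₁ ν CK δF su` and every input fraction `ρf > 0` there is an
output fraction `ρf' > 0` such that, at every label `0 < M`, `|a| < M` and far band
`max (r₊) (2M) < r_lo ≤ r_e` with the exact-frame normalisation `δF`: for every Ricci-flat
spacetime and chart `Φ` (smooth, openly embedded, injective differential on `{r > M}`) whose
components `G` satisfy on the band the tube facts at relative radius `6 su`, the scale-free
derivative bounds, the order-`0` closeness `δF`, the far point multiplier with `(ε₁, ν)` and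
stationarity, every `C^∞` solution of the coordinate Killing equation on
`ball x (ρf c) ∩ {r < c}` (`r x = c ∈ [r_lo, r_e]`) commuting with `∂₀` extends to one on
`ball x (ρf' c)`, commuting with `∂₀` and agreeing below the cylinder.
[cite: IonescuKlainerman2015, Thm 2.4, Def. 2.2, Lemma 2.17] -/
theorem ikLocalStepTFar_of_constants :
    (∀ (A A₁ δ₀ : ℝ), 1 ≤ A → A ≤ A₁ → 0 < δ₀ → δ₀ ≤ 1 → ∃ δ₁ : ℝ, 0 < δ₁ ∧ δ₁ ≤ δ₀ ∧
      ∀ (G : E4 → E4 →L[ℝ] E4 →L[ℝ] ℝ) (f : E4 → ℝ) (p τ : E4) (Z : E4 → E4),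
        MetricCoord.IsMetricOn G (Metric.ball p 1) →
        (∀ x ∈ Metric.ball p 1, MetricCoord.ricAt G x = 0) →
        G p = Minkowski.bilin →
        ContDiffOn ℝ ∞ f (Metric.ball p 1) →
        (∀ x ∈ Metric.ball p 1,
          (∑ j ∈ Finset.Icc 1 6, ‖iteratedFDeriv ℝ j G x‖) +
            (∑ j ∈ Finset.Icc 1 4, ‖iteratedFDeriv ℝ j f x‖) ≤ A) →
        f p = 0 → A₁⁻¹ ≤ ‖fderiv ℝ f p‖ →
        A₁⁻¹ ≤ ‖τ‖ → ‖τ‖ ≤ A₁ →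
        (∀ x ∈ Metric.ball p 1, fderiv ℝ G x τ = 0) →
        (∀ x ∈ Metric.ball p 1, fderiv ℝ f x τ = 0) →
        (∃ μ ∈ Icc (-A₁) A₁, ∀ X : E4,
          A₁⁻¹ * ‖X‖ ^ 2 ≤ μ * G p X X - MetricCoord.hessAt G f p X X +
            A₁ * ((fderiv ℝ f p X) ^ 2 + (G p τ X) ^ 2)) →
        ContDiffOn ℝ ∞ Z (Metric.ball p δ₀ ∩ {x | f x < 0}) →
        (∀ x ∈ Metric.ball p δ₀ ∩ {x | f x < 0}, ∀ Y W : E4,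
          fderiv ℝ G x (Z x) Y W + G x (fderiv ℝ Z x Y) W + G x Y (fderiv ℝ Z x W) = 0) →
        (∀ x ∈ Metric.ball p δ₀ ∩ {x | f x < 0}, fderiv ℝ Z x τ = 0) →
        ∃ Z' : E4 → E4, ContDiffOn ℝ ∞ Z' (Metric.ball p δ₁) ∧
          (∀ x ∈ Metric.ball p δ₁, ∀ Y W : E4,
            fderiv ℝ G x (Z' x) Y W + G x (fderiv ℝ Z' x Y) W + G x Y (fderiv ℝ Z' x W) = 0) ∧
          (∀ x ∈ Metric.ball p δ₁, fderiv ℝ Z' x τ = 0) ∧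
          EqOn Z' Z (Metric.ball p δ₁ ∩ {x | f x < 0})) →
    ∀ (ε₁ ν CK δF su : ℝ), 0 < ε₁ → 0 < ν → 0 ≤ CK → 0 < δF → 0 < su → su ≤ 1 →
      ∀ ρf : ℝ, 0 < ρf → ∃ ρf' : ℝ, 0 < ρf' ∧
      ∀ (M a r_lo r_e : ℝ), 0 < M → |a| < M → Kerr.rPlus M a < r_lo → 2 * M ≤ r_lo → r_lo ≤ r_e →
      -- (N-6a) at this label, with the constant `δF`
      (∀ (S₀ : E4 →L[ℝ] E4 →L[ℝ] ℝ) (x : E4), M < Kerr.radius a x →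
        (∀ v w : E4, S₀ v w = S₀ w v) → ‖S₀ - Kerr.bilin M a x‖ ≤ δF →
        ∃ L : E4 ≃L[ℝ] E4, (∀ v w : E4, S₀ (L v) (L w) = Minkowski.bilin v w) ∧
          ‖(L : E4 →L[ℝ] E4)‖ ≤ 6 ∧ ‖(L.symm : E4 →L[ℝ] E4)‖ ≤ 6) →
      ∀ (𝓢 : Spacetime.{0} 4) [𝓢.metric.HasLeviCivita] (Φ : E4 → 𝓢.carrier),
        𝓢.metric.toPseudoRiemannianMetric.IsRicciFlat →
        ContMDiffOn 𝓘(ℝ, E4) (𝓡 4) ∞ Φ {z | M < Kerr.radius a z} →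
        Topology.IsOpenEmbedding ({z : E4 | M < Kerr.radius a z}.restrict Φ) →
        (∀ z : E4, M < Kerr.radius a z → Function.Injective (mfderiv 𝓘(ℝ, E4) (𝓡 4) Φ z)) →
        -- (FT) tube facts at relative radius `6 su` around band points
        (∀ z : E4, r_lo ≤ Kerr.radius a z → Kerr.radius a z ≤ r_e → ∀ w : E4,
          ‖w‖ ≤ 6 * su * Kerr.radius a z →
          M < Kerr.radius a (z + w) ∧ Kerr.radius a z / 2 ≤ Kerr.radius a (z + w) ∧
          ContDiffAt ℝ ∞ (Kerr.radius a) (z + w) ∧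
          (∀ j : ℕ, 1 ≤ j → j ≤ 6 →
            ‖iteratedFDeriv ℝ j (𝓢.metricInCoords Φ) (z + w)‖ ≤
              (CK + 1) * M / Kerr.radius a (z + w) ^ (j + 1)) ∧
          (∀ j : ℕ, 1 ≤ j → j ≤ 4 →
            ‖iteratedFDeriv ℝ j (Kerr.radius a) (z + w)‖ ≤ CK / Kerr.radius a (z + w) ^ (j - 1)) ∧
          (∀ t : ℝ, 𝓢.metricInCoords Φ (z + w + t • E4.basisVector 0) = 𝓢.metricInCoords Φ (z + w))) →
        -- (FC) order-0 closeness for the frame and (FM) the far point multiplier at band points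
        (∀ z : E4, r_lo ≤ Kerr.radius a z → Kerr.radius a z ≤ r_e →
          ‖𝓢.metricInCoords Φ z - Kerr.bilin M a z‖ ≤ δF ∧ ν ≤ ‖fderiv ℝ (Kerr.radius a) z‖ ∧
          ∃ μ : ℝ, |μ| ≤ ε₁⁻¹ ∧ ∀ w : E4,
            ε₁ ^ 2 * ‖w‖ ^ 2 ≤ μ * 𝓢.metricInCoords Φ z w w
              - Kerr.radius a z * hessAt (𝓢.metricInCoords Φ) (Kerr.radius a) z w w
              + ε₁⁻¹ ^ 2 * ((𝓢.metricInCoords Φ z (E4.basisVector 0) w) ^ 2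
                + (fderiv ℝ (Kerr.radius a) z w) ^ 2)) →
        ∀ c ∈ Icc r_lo r_e, ∀ x : E4, Kerr.radius a x = c → ∀ k : E4 → E4,
          ContDiffOn ℝ ∞ k (ball x (ρf * c) ∩ {y | Kerr.radius a y < c}) →
          (∀ y ∈ ball x (ρf * c) ∩ {y | Kerr.radius a y < c}, ∀ Y Z : E4,
            fderiv ℝ (𝓢.metricInCoords Φ) y (k y) Y Z + 𝓢.metricInCoords Φ y (fderiv ℝ k y Y) Z
              + 𝓢.metricInCoords Φ y Y (fderiv ℝ k y Z) = 0) →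
          (∀ y ∈ ball x (ρf * c) ∩ {y | Kerr.radius a y < c}, fderiv ℝ k y (E4.basisVector 0) = 0) →
          ∃ k' : E4 → E4, ContDiffOn ℝ ∞ k' (ball x (ρf' * c)) ∧
            (∀ y ∈ ball x (ρf' * c), ∀ Y Z : E4,
              fderiv ℝ (𝓢.metricInCoords Φ) y (k' y) Y Z + 𝓢.metricInCoords Φ y (fderiv ℝ k' y Y) Z
                + 𝓢.metricInCoords Φ y Y (fderiv ℝ k' y Z) = 0) ∧
            (∀ y ∈ ball x (ρf' * c), fderiv ℝ k' y (E4.basisVector 0) = 0) ∧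
            EqOn k' k (ball x (ρf' * c) ∩ {y | Kerr.radius a y < c}) := by
  intro hIKC ε₁ ν CK δF su hε₁ hν hCK _hδF hsu hsu1 ρf hρf
  -- the unit fraction `su'` of the scale: tube (`≤ su`) and input ball (`12 su' ≤ ρf`)
  set su' : ℝ := min su (ρf / 12) with hsu'def
  have hsu'pos : 0 < su' := lt_min hsu (by positivity)
  have hsu'su : su' ≤ su := min_le_left _ _
  have hsu'1 : su' ≤ 1 := hsu'su.trans hsu1
  have hsu'ρ : 12 * su' ≤ ρf := by
    have : su' ≤ ρf / 12 := min_le_right _ _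
    linarith
  -- IK constants (scale-free)
  set A : ℝ := 1 + (6 * (6 ^ 8 * 2 ^ 7 * (CK + 1)) + 4 * (6 ^ 4 * 8 * CK) / su') with hAdef
  have hA1 : 1 ≤ A := by
    have h1 : 0 ≤ 6 * (6 ^ 8 * 2 ^ 7 * (CK + 1)) := by positivity
    have h2 : 0 ≤ 4 * (6 ^ 4 * 8 * CK) / su' := by positivity
    rw [hAdef]; linarith only [h1, h2]
  set A₁ : ℝ := max A (max (36 * ε₁⁻¹ ^ 2) (max ε₁⁻¹ (max (6 / ν) (6 / su')))) with hA₁def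
  have hAA₁ : A ≤ A₁ := le_max_left _ _
  have hA₁pos : 0 < A₁ := lt_of_lt_of_le (lt_of_lt_of_le one_pos hA1) hAA₁
  have hA₁ε2 : 36 * ε₁⁻¹ ^ 2 ≤ A₁ := (le_max_left _ _).trans (le_max_right _ _)
  have hA₁ε : ε₁⁻¹ ≤ A₁ := ((le_max_left _ _).trans (le_max_right _ _)).trans (le_max_right _ _)
  have hA₁ν : 6 / ν ≤ A₁ :=
    (((le_max_left _ _).trans (le_max_right _ _)).trans (le_max_right _ _)).trans (le_max_right _ _)
  have hA₁s : 6 / su' ≤ A₁ :=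
    (((le_max_right _ _).trans (le_max_right _ _)).trans (le_max_right _ _)).trans (le_max_right _ _)
  obtain ⟨δ₁, hδ₁, hδ₁1, hIKC'⟩ := hIKC A A₁ 1 hA1 hAA₁ one_pos le_rfl
  refine ⟨su' * δ₁ / 6, by positivity, ?_⟩
  intro M a r_lo r_e hM _ha hlo h2M _hloe hF 𝓢 _ Φ hRF hΦ _hemb hinjd htubeH hptH c hc x hx k hk
    hkeq hkinv
  have hrpM : M ≤ Kerr.rPlus M a := le_add_of_nonneg_right (Real.sqrt_nonneg _)
  have hcpos : 0 < c := by linarith [hc.1]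
  have hMc : M ≤ c := by linarith [hc.1]
  -- the chart components as a metric datum on the star domain `W = {r > M}`
  set G : E4 → E4 →L[ℝ] E4 →L[ℝ] ℝ := 𝓢.metricInCoords Φ with hGdef
  set W : Set E4 := {z | M < Kerr.radius a z} with hWdef
  have hW : IsOpen W := isOpen_lt continuous_const (Kerr.continuous_radius a)
  have hGmet : IsMetricOn G W := stub_isMetricOn_metricInCoords 𝓢 Φ W hW hΦ hinjd
  have hric : ∀ z ∈ W, ricAt G z = 0 := fun z hz ↦
    killingLoc_ricAt_metricInCoords_eq_zero 𝓢 Φ W hW hΦ hinjd hRF hz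
  -- the point `x` on the cylinder `{r = c}`
  have hxlo : r_lo ≤ Kerr.radius a x := hx ▸ hc.1
  have hxe : Kerr.radius a x ≤ r_e := hx ▸ hc.2
  have hxM : M < Kerr.radius a x := by linarith only [hrpM, hlo, hxlo]
  have hxW : x ∈ W := hxM
  obtain ⟨hGx_close, hνx, μ₀, hμ₀, hUin⟩ := hptH x hxlo hxe
  rw [hx] at hUin
  -- the exact frame at `x` and the scale `s = c su'`
  obtain ⟨L, hL, hL6, hLs6⟩ := hF (G x) x hxM (fun v w ↦ 𝓢.metricInCoords_symm Φ x v w) hGx_close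
  set s : ℝ := c * su' with hsdef
  have hspos : 0 < s := mul_pos hcpos hsu'pos
  have hs0 : s ≠ 0 := hspos.ne'
  obtain ⟨Ls, hLs, hLss⟩ := ikStep_exists_smul_equiv L hs0
  have hLs_apply : ∀ v : E4, Ls v = s • L v := fun v ↦ by
    simpa using DFunLike.congr_fun hLs v
  -- tube facts at the affine points `x + Ls y`, `‖y‖ ≤ 1`
  have htube : ∀ y : E4, ‖y‖ ≤ 1 →
      x + Ls y ∈ ball x (ρf * c) ∧ x + Ls y ∈ W ∧ c / 2 ≤ Kerr.radius a (x + Ls y) ∧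
      ContDiffAt ℝ ∞ (Kerr.radius a) (x + Ls y) ∧
      (∀ j : ℕ, 1 ≤ j → j ≤ 6 →
        ‖iteratedFDeriv ℝ j G (x + Ls y)‖ ≤ (CK + 1) * M / Kerr.radius a (x + Ls y) ^ (j + 1)) ∧
      (∀ j : ℕ, 1 ≤ j → j ≤ 4 →
        ‖iteratedFDeriv ℝ j (Kerr.radius a) (x + Ls y)‖ ≤ CK / Kerr.radius a (x + Ls y) ^ (j - 1)) ∧
      (∀ t : ℝ, G (x + Ls y + t • E4.basisVector 0) = G (x + Ls y)) := by
    intro y hy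
    have hw : ‖Ls y‖ ≤ 6 * s := by
      calc ‖Ls y‖ ≤ ‖(Ls : E4 →L[ℝ] E4)‖ * ‖y‖ := (Ls : E4 →L[ℝ] E4).le_opNorm y
        _ ≤ 6 * s * 1 := by
            gcongr
            exact ikStep_norm_Ls hspos hLs hL6
        _ = 6 * s := by ring
    have hw' : ‖Ls y‖ ≤ 6 * su * Kerr.radius a x := by
      rw [hx]
      calc ‖Ls y‖ ≤ 6 * s := hw
        _ = 6 * su' * c := by rw [hsdef]; ring
        _ ≤ 6 * su * c := by gcongr
    obtain ⟨hMy, hry, hcd, hjG, hjr, hst⟩ := htubeH x hxlo hxe (Ls y) hw'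
    rw [hx] at hry
    have hball : x + Ls y ∈ ball x (ρf * c) := by
      rw [mem_ball, dist_eq_norm, add_sub_cancel_left]
      calc ‖Ls y‖ ≤ 6 * s := hw
        _ = (6 * su') * c := by rw [hsdef]; ring
        _ < ρf * c := by
            apply mul_lt_mul_of_pos_right _ hcpos
            linarith
    exact ⟨hball, hMy, hry, hcd, hjG, hjr, hst⟩
  have haff0 : x + Ls 0 = x := by simp
  have hmem1 : ∀ y : E4, y ∈ ball (0 : E4) 1 → ‖y‖ ≤ 1 := fun y hy ↦ (mem_ball_zero_iff.1 hy).le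
  -- the normalised data (opaque names with defining equations)
  obtain ⟨Gt, hGt⟩ : ∃ Gt : E4 → E4 →L[ℝ] E4 →L[ℝ] ℝ, ∀ y : E4, Gt y =
      (s ^ 2)⁻¹ • (G (x + Ls y)).bilinearComp (Ls : E4 →L[ℝ] E4) (Ls : E4 →L[ℝ] E4) :=
    ⟨_, fun _ ↦ rfl⟩
  obtain ⟨ft, hft⟩ : ∃ ft : E4 → ℝ, ∀ y : E4,
      ft y = c * (s ^ 2)⁻¹ * (Kerr.radius a (x + Ls y) - c) := ⟨_, fun _ ↦ rfl⟩
  obtain ⟨ft₀, hft₀⟩ : ∃ ft₀ : E4 → ℝ, ∀ y : E4,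
      ft₀ y = (s ^ 2)⁻¹ * (Kerr.radius a (x + Ls y) - c) := ⟨_, fun _ ↦ rfl⟩
  have hftft₀ : ft = fun y => c * ft₀ y := by
    funext y; rw [hft, hft₀]; ring
  obtain ⟨kt, hkt⟩ : ∃ kt : E4 → E4, ∀ y : E4, kt y = (Ls.symm : E4 →L[ℝ] E4) (k (x + Ls y)) :=
    ⟨_, fun _ ↦ rfl⟩
  obtain ⟨τ, hτ⟩ : ∃ τ : E4, τ = c • (Ls.symm : E4 →L[ℝ] E4) (E4.basisVector 0) := ⟨_, rfl⟩
  have hLsτ : Ls τ = c • E4.basisVector 0 := by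
    rw [hτ, map_smul]; exact congrArg (c • ·) (Ls.apply_symm_apply _)
  -- IK's hypotheses at `p = 0`
  obtain ⟨hGtmetW, hGtricW, hGt0, -, -⟩ := ikStep_Gt_basic hGmet hric hspos hLs_apply hL hGt
  have hball_sub : ball (0 : E4) 1 ⊆ (fun y : E4 => x + Ls y) ⁻¹' W := fun y hy ↦
    (htube y (hmem1 y hy)).2.1
  have hGtmet : IsMetricOn Gt (ball 0 1) := ikStep_isMetricOn_mono hGtmetW isOpen_ball hball_sub
  have hGtric : ∀ y ∈ ball (0 : E4) 1, ricAt Gt y = 0 := fun y hy ↦ hGtricW y (hball_sub hy)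
  have hr0x : ContDiffAt ℝ ∞ (Kerr.radius a) x := by
    have h := (htube 0 (by simp)).2.2.2.1
    rwa [haff0] at h
  obtain ⟨hft₀0, -, -, hft₀cd⟩ := ikStep_ft_basic hspos hLs_apply hx hft₀ hr0x
  have hft0 : ft 0 = 0 := by rw [hftft₀]; simp [hft₀0]
  have hft_cd : ContDiffOn ℝ ∞ ft (ball 0 1) := by
    rw [hftft₀]
    exact fun y hy ↦ (contDiffAt_const.mul
      (hft₀cd y (htube y (hmem1 y hy)).2.2.2.1)).contDiffWithinAt
  have hAbound : ∀ y ∈ ball (0 : E4) 1,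
      (∑ j ∈ Finset.Icc 1 6, ‖iteratedFDeriv ℝ j Gt y‖) +
        (∑ j ∈ Finset.Icc 1 4, ‖iteratedFDeriv ℝ j ft y‖) ≤ A := by
    intro y hy
    obtain ⟨-, hyW, hry, hcd, hjG, hjr, -⟩ := htube y (hmem1 y hy)
    have h := stub_ikStepBoundAFar G W a c s su' M CK x y L Ls Gt ft hGmet hcpos hsu'pos hsu'1 rfl hM
      hMc hCK hLs hL6 hGt hft hyW hry hcd hjG hjr
    rw [hAdef]; linarith only [h]
  obtain ⟨hft_norm, hτlo, hτhi, hq6⟩ := stub_ikQuant6TFar G W a c s su' x L Ls Gt ft τ ν ε₁ μ₀ A₁ hGmet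
    hric hxW hcpos hsu'pos hsu'1 rfl hLs_apply hL hL6 hLs6 hGt hx hft hτ hr0x hν hε₁ hA₁pos hνx hμ₀
    hUin hA₁ε2 hA₁ε hA₁ν hA₁s
  -- invariance of the normalised metric and of the defining function along `τ`
  have hGtinv : ∀ y ∈ ball (0 : E4) 1, fderiv ℝ Gt y τ = 0 := by
    intro y hy
    obtain ⟨-, -, -, -, -, -, hst⟩ := htube y (hmem1 y hy)
    have hd : DifferentiableAt ℝ Gt y :=
      ((hGtmet.contDiffOn y hy).contDiffAt (isOpen_ball.mem_nhds hy)).differentiableAt (by simp)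
    refine ikStepT_fderiv_eq_zero_of_forall_add_smul hd fun t' ↦ ?_
    rw [hGt, hGt, map_add, map_smul, hLsτ, smul_smul, ← add_assoc, hst (t' * c)]
  have hrad_add : ∀ (z : E4) (t : ℝ), Kerr.radius a (z + t • E4.basisVector 0) = Kerr.radius a z := by
    intro z t
    refine Kerr.radius_eq_of_spatial_eq a ?_
    have h0 : E4.spatial (E4.basisVector 0) = 0 := by ext i; simp
    rw [map_add, map_smul, h0, smul_zero, add_zero]
  have hftinv : ∀ y ∈ ball (0 : E4) 1, fderiv ℝ ft y τ = 0 := by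
    intro y hy
    have hd : DifferentiableAt ℝ ft y :=
      ((hft_cd y hy).contDiffAt (isOpen_ball.mem_nhds hy)).differentiableAt (by simp)
    refine ikStepT_fderiv_eq_zero_of_forall_add_smul hd fun t' ↦ ?_
    rw [hft, hft, map_add, map_smul, hLsτ, smul_smul, ← add_assoc, hrad_add]
  -- the datum in the normalised chart and its invariance
  obtain ⟨hkt_cd, hkt_eq⟩ := ikStep_kt_input hGmet hspos hGt hft₀ hk hkeq
    (fun y hy ↦ ⟨(htube y hy).1, (htube y hy).2.1⟩) hkt
  have hsub₀ : ∀ y : E4, ft y < 0 → ft₀ y < 0 := by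
    intro y hyf
    rw [hftft₀] at hyf
    exact neg_of_mul_neg_right (by simpa using hyf) hcpos.le
  have hkt_cd' : ContDiffOn ℝ ∞ kt (ball 0 1 ∩ {y | ft y < 0}) :=
    hkt_cd.mono fun y hy ↦ ⟨hy.1, hsub₀ y hy.2⟩
  have hkt_eq' : ∀ y ∈ ball (0 : E4) 1 ∩ {y | ft y < 0}, ∀ Y Z : E4,
      fderiv ℝ Gt y (kt y) Y Z + Gt y (fderiv ℝ kt y Y) Z + Gt y Y (fderiv ℝ kt y Z) = 0 :=
    fun y hy ↦ hkt_eq y ⟨hy.1, hsub₀ y hy.2⟩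
  have hO : IsOpen (ball x (ρf * c) ∩ {y | Kerr.radius a y < c}) :=
    isOpen_ball.inter (isOpen_lt (Kerr.continuous_radius a) continuous_const)
  have hktinv : ∀ y ∈ ball (0 : E4) 1 ∩ {y | ft y < 0}, fderiv ℝ kt y τ = 0 := by
    rintro y ⟨hy, hyf⟩
    have hyc : Kerr.radius a (x + Ls y) < c := by
      have h : (s ^ 2)⁻¹ * (Kerr.radius a (x + Ls y) - c) < 0 := by rw [← hft₀]; exact hsub₀ y hyf
      exact sub_neg.1 (neg_of_mul_neg_right h (inv_nonneg.2 (sq_nonneg s)))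
    have hmem : x + Ls y ∈ ball x (ρf * c) ∩ {y | Kerr.radius a y < c} := ⟨(htube y (hmem1 y hy)).1, hyc⟩
    have hkd : DifferentiableAt ℝ k (x + Ls y) :=
      ((hk _ hmem).contDiffAt (hO.mem_nhds hmem)).differentiableAt (by simp)
    rw [funext hkt, ikStepT_fderiv_comp_affine_apply _ _ _ _ Ls (Ls.symm : E4 →L[ℝ] E4) hkd, hLsτ,
      map_smul, hkinv _ hmem, smul_zero, map_zero]
  -- Ionescu–Klainerman (conditional) at the origin of the normalised chart
  obtain ⟨Z', hZ'cd, hZ'eq, hZ'inv, hZ'agree⟩ :=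
    hIKC' Gt ft 0 τ kt hGtmet hGtric hGt0 hft_cd hAbound hft0 hft_norm hτlo hτhi hGtinv hftinv hq6
      hkt_cd' hkt_eq' hktinv
  -- back to the chart `Φ`: `ball x (s δ₁ / 6) = ball x (ρf' c)`
  have hZ'agree₀ : EqOn Z' kt (ball 0 δ₁ ∩ {y | ft₀ y < 0}) := by
    intro y hy
    refine hZ'agree ⟨hy.1, ?_⟩
    show ft y < 0
    rw [hftft₀]; exact mul_neg_of_pos_of_neg hcpos hy.2
  obtain ⟨k', hk'⟩ : ∃ k' : E4 → E4, ∀ y' : E4,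
      k' y' = Ls (Z' ((Ls.symm : E4 →L[ℝ] E4) (y' - x))) := ⟨_, fun _ ↦ rfl⟩
  obtain ⟨h1, h2, h3⟩ := stub_ikKillingBack G W a c s x L Ls Gt ft₀ k kt Z' k' δ₁ hGmet hspos hLss hLs6
    hGt hft₀ (fun y hy ↦ (htube y hy).2.1) hkt hδ₁1 hZ'cd hZ'eq hZ'agree₀ hk'
  have hrad : s * δ₁ / 6 = su' * δ₁ / 6 * c := by rw [hsdef]; ring
  rw [hrad] at h1 h2 h3
  refine ⟨k', h1, h2, fun y' hy' ↦ ?_, h3⟩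
  -- invariance of the extension
  have hw : (Ls.symm : E4 →L[ℝ] E4) (y' - x) ∈ ball (0 : E4) δ₁ := by
    rw [mem_ball_zero_iff]
    rw [mem_ball, dist_eq_norm] at hy'
    calc ‖(Ls.symm : E4 →L[ℝ] E4) (y' - x)‖ ≤ ‖(Ls.symm : E4 →L[ℝ] E4)‖ * ‖y' - x‖ :=
          (Ls.symm : E4 →L[ℝ] E4).le_opNorm _
      _ ≤ (6 / s) * ‖y' - x‖ := by
          gcongr
          rw [hLss, norm_smul, Real.norm_eq_abs, abs_of_pos (inv_pos.2 hspos), div_eq_inv_mul]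
          exact mul_le_mul_of_nonneg_left hLs6 (inv_pos.2 hspos).le
      _ < (6 / s) * (su' * δ₁ / 6 * c) := by gcongr
      _ = δ₁ := by rw [hsdef]; field_simp
  have hZd : DifferentiableAt ℝ Z' ((Ls.symm : E4 →L[ℝ] E4) (y' - x)) :=
    ((hZ'cd _ hw).contDiffAt (isOpen_ball.mem_nhds hw)).differentiableAt (by simp)
  have hrew : k' = fun y' : E4 => (Ls : E4 →L[ℝ] E4) (Z' ((-((Ls.symm : E4 →L[ℝ] E4) x)) +
      Ls.symm y')) := by
    funext z; rw [hk', map_sub]; simp only [ContinuousLinearEquiv.coe_coe]; abel_nf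
  have hpt : (-((Ls.symm : E4 →L[ℝ] E4) x)) + Ls.symm y' = (Ls.symm : E4 →L[ℝ] E4) (y' - x) := by
    rw [map_sub]; simp only [ContinuousLinearEquiv.coe_coe]; abel
  have hτ' : c • Ls.symm (E4.basisVector 0) = τ := by rw [hτ]; rfl
  have hcinv : Ls.symm (E4.basisVector 0) = c⁻¹ • τ := by
    rw [← hτ', smul_smul, inv_mul_cancel₀ hcpos.ne', one_smul]
  rw [hrew, ikStepT_fderiv_comp_affine_apply _ _ _ _ Ls.symm (Ls : E4 →L[ℝ] E4) (by rw [hpt]; exact hZd),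
    hpt, hcinv, map_smul, hZ'inv _ hw, smul_zero, map_zero]

end Summit.FinalStateConjecture.FinalStateConjecture.Theorems

end
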